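import Mathlib.Analysis.Matrix.Normed
import Mathlib.Analysis.Normed.Algebra.Exponential
import Mathlib.Topology.Algebra.Module.FiniteDimension
import Literature.MathematicalPhysics.FreeFermions.MajoranaField
import Literature.Computability.QuantumComplexity.GaussianRank
import Literature.Analysis.Calculus.ExpDifferentialAdSeries
import HarnessLib

/-!
# Quadratic Majorana Hamiltonians: conjugation by the exponential is a one-body rotation (Jozsa–Miyake 2008, Thm. 3)

Topic `MathematicalPhysics/FreeFermions`, namespace `Literature.MathematicalPhysics.FreeFermions`;
continuation of `MajoranaField.lean` (`IsMajoranaFamily`, `fieldOp Γ w = ∑ w_a Γ_a`, `Implements`).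
The basic theorem of "fermionic linear optics" / free-fermion (Gaussian) dynamics: for a Majorana
family `Γ : ι → Matrix n n ℂ` (`Γ_a² = 1`, `Γ_a Γ_b = −Γ_b Γ_a`, `Γ_aᴴ = Γ_a`) and ANY coefficient
matrix `h : Matrix ι ι ℂ`, the exponential of the quadratic operator `Q = ∑_{a,b} h_{ab} Γ_a Γ_b` —
an element of the `2^{|ι|}`-dimensional Clifford algebra "which generally involves all products of
all generators" — conjugates the field operators WITHIN the `|ι|`-dimensional span of the
generators, by the `|ι| × |ι|` matrix exponential of the one-body generator `B = 2(h − hᵀ)`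
(`= 4h` for antisymmetric `h`):

  `e^{Q} Γ(w) e^{−Q} = Γ(e^{B} w)`            (`exp_quadHam_mul_fieldOp_mul_exp_neg`).

R. Jozsa, A. Miyake, *Matchgates and classical simulation of quantum circuits*, Proc. R. Soc. A 464
(2008) 3089, §4, **Theorem 3** ("Let `H = i ∑_{μ≠ν} h_{μν} c_μ c_ν` be any quadratic Hamiltonian and
`U = e^{iH}` … then `U† c_μ U = ∑_ν R_{μν} c_ν` where `R ∈ SO(2n)` … In fact `R = e^{4h}`"; proof:
"`dc_μ(t)/dt = i[H, c_μ(t)]` … `[c_μ c_ν, c_μ] = −2c_ν` … `c_μ(t) = ∑_ν R_{μν}(t) c_ν(0)` where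
`R = e^{4ht}`"), crediting Knill 2001, Terhal–DiVincenzo 2002, Bravyi 2005. This is the identity that
makes non-interacting-fermion dynamics classically simulable by `|ι| × |ι|` linear algebra
(Terhal–DiVincenzo 2002) — the decl the `pub-qadeq` chemistry-dynamics rows (A-100, A-223) cite for
"this corner is free fermions".

## Main declarations (all PROVED, Mathlib + two tree files, no named facts)

* `quadHam Γ h = ∑_{a,b} h_{ab} Γ_a Γ_b`, `oneBody h = 2 (h − hᵀ)`; `quadHam_neg`, `quadHam_smul`,
  `conjTranspose_quadHam` (`(quadHam Γ h)ᴴ = quadHam Γ hᴴ`), `oneBody_of_transpose_eq_neg` (`= 4h`).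
* `pair_mul_gen_sub`: `[Γ_a Γ_b, Γ_c] = 2δ_{bc} Γ_a − 2δ_{ac} Γ_b`; `quadHam_mul_gen_sub`;
  `quadHam_mul_fieldOp_sub`: **`[Q, Γ(w)] = Γ(B w)`** (JM08, proof of Thm. 3).
* `ad_quadHam_pow_fieldOp`: `(ad Q)^k Γ(w) = Γ(B^k w)`; `exp_ad_quadHam_fieldOp`:
  `e^{ad Q} Γ(w) = Γ(e^{B} w)` (exponential series, term by term).
* **`exp_quadHam_mul_fieldOp_mul_exp_neg`**: `e^{Q} Γ(w) e^{−Q} = Γ(e^{B} w)`, from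
  `Ad(e^{Q}) = e^{ad Q}` (`Literature.Analysis.Calculus.ExpDifferential.exp_ad_apply`, Hall 2015
  Prop. 3.35); `…_of_transpose` (`B = 4h`); `exp_quadHam_mul_gen_mul_exp_neg` (generator form
  `e^{Q} Γ_c e^{−Q} = ∑_a (e^{B})_{ac} Γ_a`); `exp_neg_quadHam_mul_fieldOp_mul_exp` (the `U† · U`
  form); `implements_exp_quadHam` (`Implements Γ (e^{Q}) (e^{B} ·)` in the sense of `MajoranaField`);
  `exp_quadHam_mul_fieldOp_mul_fieldOp_mul_exp_neg` (bilinears `Γ(v)Γ(w)` rotate slotwise — hence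
  two-point functions evolve by `e^{B}`, JM08 after Thm. 3 / Terhal–DiVincenzo 2002).
* `isMajoranaFamily_majorana`: the tree's `m`-qubit Jordan–Wigner Majoranas
  (`Literature.Computability.QuantumComplexity.majorana`) form a Majorana family (JM08 §5), and
  `jordanWigner_exp_quadHam_mul_fieldOp_mul_exp_neg` is the main theorem for them.

## Dictionary with the printed statement

JM08 write `H = i ∑ h_{μν} c_μ c_ν` with `h` real antisymmetric and `U(t) = e^{iHt}`; then
`iHt = quadHam c (−t h)` and our generator form gives
`c_μ(t) := U(t) c_μ U(t)† = ∑_ν (e^{oneBody(−th)})_{νμ} c_ν = ∑_ν (e^{−4th})_{νμ} c_ν = ∑_ν (e^{4ht})_{μν} c_ν`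
(`(e^{−4th})ᵀ = e^{4th}` by antisymmetry) — their "`c_μ(t) = ∑_ν R_{μν}(t) c_ν(0)`, `R = e^{4ht}`".
The theorem here is stated over `ℂ` for every `h` (no antisymmetry, Hermiticity or reality
hypothesis); `R = e^{B}` is orthogonal when `B` is antisymmetric and real when `B` is, which is not
needed and not proved here. NOT covered: the converse ("we obtain all of SO(2n) in this way"), and
JM08 Thms. 1, 4, 5 (matchgate circuits).

## Technique

`NormedSpace.exp` on matrices needs no norm; inside the proofs the `L^∞` operator norm is switched
on (`open scoped Matrix.Norms.Operator`, as in `Mathlib.Analysis.Normed.Algebra.MatrixExponential`)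
and the exponential SERIES of `ad Q` (in `Matrix n n ℂ →L[ℂ] Matrix n n ℂ`) and of `B`
(in `Matrix ι ι ℂ`) are compared term by term through the continuous linear maps "evaluate at
`Γ(w)`" and `M ↦ Γ(M w)`.

## References

* [JozsaMiyake2008] R. Jozsa, A. Miyake, Proc. R. Soc. A 464 (2008) 3089–3106, arXiv:0804.4050:
  §4 (quadratic Hamiltonians), Theorem 3 and its proof; §5 (Jordan–Wigner representation).
* [TerhalDivincenzo2002] B. M. Terhal, D. P. DiVincenzo, *Classical simulation of
  noninteracting-fermion quantum circuits*, Phys. Rev. A 65 (2002) 032325.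
* [Bravyi2005] S. Bravyi, *Lagrangian representation for fermionic linear optics*, QIC 5 (2005) 216.
* [Hall2015] B. C. Hall, *Lie Groups, Lie Algebras, and Representations*, 2nd ed., Prop. 3.35
  (`Ad(e^X) = e^{ad X}`), via `Literature.Analysis.Calculus.ExpDifferential`.
-/

noncomputable section

open Matrix Finset NormedSpace
open scoped Nat

namespace Literature.MathematicalPhysics.FreeFermions

variable {n ι : Type*} [Fintype n] [DecidableEq n] [Fintype ι] [DecidableEq ι]

/-- The **quadratic (bilinear) operator** of a coefficient matrix `h`:
`quadHam Γ h = ∑_{a,b} h_{ab} Γ_a Γ_b` (Jozsa–Miyake 2008, §4: "a quadratic Hamiltonian is an element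
of the Clifford algebra of the form `H = i ∑_{μ ≠ ν} h_{μν} c_μ c_ν`"; here without the prefactor `i`,
and the diagonal terms `h_{aa} Γ_a² = h_{aa} · 1` are allowed — they are central).
[cite: JozsaMiyake2008, §4, eq. before Thm. 3] -/
def quadHam (Γ : ι → Matrix n n ℂ) (h : Matrix ι ι ℂ) : Matrix n n ℂ :=
  ∑ a, ∑ b, h a b • (Γ a * Γ b)

/-- The **one-body generator** induced by `h` on coefficient vectors: `2 (h - hᵀ)` (`= 4h` for
antisymmetric `h`; Jozsa–Miyake 2008, proof of Thm. 3: "`dc_μ/dt = ∑_ν 4 h_{μν} c_ν`").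
[cite: JozsaMiyake2008, proof of Thm. 3] -/
def oneBody (h : Matrix ι ι ℂ) : Matrix ι ι ℂ := (2 : ℂ) • (h - hᵀ)

omit [Fintype ι] [DecidableEq ι] in
/-- For antisymmetric `h` the one-body generator is `4h`. [cite: JozsaMiyake2008, Thm. 3] -/
theorem oneBody_of_transpose_eq_neg {h : Matrix ι ι ℂ} (hh : hᵀ = -h) : oneBody h = (4 : ℂ) • h := by
  rw [oneBody, hh, sub_neg_eq_add, ← two_smul ℂ h, smul_smul]
  norm_num

omit [Fintype ι] [DecidableEq ι] in
/-- `oneBody (−h) = −oneBody h`. [cite: JozsaMiyake2008, proof of Thm. 3] -/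
theorem oneBody_neg (h : Matrix ι ι ℂ) : oneBody (-h) = -oneBody h := by
  simp only [oneBody, transpose_neg, neg_sub_neg, smul_sub, neg_sub]

omit [DecidableEq n] [DecidableEq ι] in
/-- `quadHam Γ (−h) = −quadHam Γ h` (linearity in the coefficient matrix). [cite: JozsaMiyake2008, §4] -/
theorem quadHam_neg (Γ : ι → Matrix n n ℂ) (h : Matrix ι ι ℂ) : quadHam Γ (-h) = -quadHam Γ h := by
  simp only [quadHam, Matrix.neg_apply, neg_smul, sum_neg_distrib]

omit [DecidableEq n] [DecidableEq ι] in
/-- `quadHam Γ (c • h) = c • quadHam Γ h`. [cite: JozsaMiyake2008, §4] -/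
theorem quadHam_smul (Γ : ι → Matrix n n ℂ) (c : ℂ) (h : Matrix ι ι ℂ) :
    quadHam Γ (c • h) = c • quadHam Γ h := by
  simp only [quadHam, Matrix.smul_apply, smul_eq_mul, mul_smul, smul_sum]

omit [DecidableEq n] [DecidableEq ι] in
/-- Adjoint: `(quadHam Γ h)ᴴ = quadHam Γ hᴴ` for Hermitian generators — so `quadHam Γ h` is
Hermitian when `hᴴ = h` (e.g. `h = (i/4) A`, `A` real antisymmetric: Jozsa–Miyake's
"imposing `H = H†` we may take `h` to be a real antisymmetric matrix" for `H = i ∑ h c c`).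
[cite: JozsaMiyake2008, §4] -/
theorem conjTranspose_quadHam {Γ : ι → Matrix n n ℂ} (hΓ : ∀ a, (Γ a)ᴴ = Γ a) (h : Matrix ι ι ℂ) :
    (quadHam Γ h)ᴴ = quadHam Γ hᴴ := by
  simp only [quadHam, conjTranspose_sum, conjTranspose_smul, conjTranspose_mul, hΓ,
    conjTranspose_apply]
  rw [sum_comm]

variable {Γ : ι → Matrix n n ℂ}

/-! ### The commutator of a quadratic operator with a field operator -/

omit [Fintype ι] in
/-- `[Γ_a Γ_b, Γ_c] = 2 δ_{bc} Γ_a − 2 δ_{ac} Γ_b` (Jozsa–Miyake 2008, proof of Thm. 3: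
"`[c_{ν₁} c_{ν₂}, c_μ] = 0` if `μ ≠ ν₁, ν₂` and `[c_μ c_ν, c_μ] = −2 c_ν`").
[cite: JozsaMiyake2008, proof of Thm. 3] -/
theorem pair_mul_gen_sub (hΓ : IsMajoranaFamily Γ) (a b c : ι) :
    Γ a * Γ b * Γ c - Γ c * (Γ a * Γ b) =
      (if b = c then (2 : ℂ) • Γ a else 0) - (if a = c then (2 : ℂ) • Γ b else 0) := by
  by_cases hab : a = b
  · subst hab
    by_cases hac : a = c
    · subst hac; simp [hΓ.mul_self]
    · rw [if_neg hac, hΓ.mul_self, one_mul, mul_one, sub_self, sub_self]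
  by_cases hac : a = c
  · subst hac
    rw [if_neg (fun h => hab h.symm), if_pos rfl, zero_sub, mul_assoc, hΓ.anticomm (Ne.symm hab), mul_neg,
      ← mul_assoc, hΓ.mul_self, one_mul, two_smul]
    abel
  by_cases hbc : b = c
  · subst hbc
    rw [if_pos rfl, if_neg hac, sub_zero, mul_assoc, hΓ.mul_self, mul_one, ← mul_assoc,
      hΓ.anticomm (Ne.symm hab) , neg_mul, mul_assoc, hΓ.mul_self, mul_one, two_smul, sub_neg_eq_add]
  · rw [if_neg hbc, if_neg hac, sub_zero, mul_assoc, hΓ.anticomm hbc, mul_neg, ← mul_assoc,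
      hΓ.anticomm hac, neg_mul, neg_neg, mul_assoc, sub_self]

/-- `[quadHam h, Γ_c] = 2 ∑_a h_{ac} Γ_a − 2 ∑_b h_{cb} Γ_b = 2 Γ(h e_c) − 2 Γ(hᵀ e_c)`.
[cite: JozsaMiyake2008, proof of Thm. 3] -/
theorem quadHam_mul_gen_sub (hΓ : IsMajoranaFamily Γ) (h : Matrix ι ι ℂ) (c : ι) :
    quadHam Γ h * Γ c - Γ c * quadHam Γ h =
      (2 : ℂ) • (fieldOp Γ (fun a => h a c) - fieldOp Γ (fun b => h c b)) := by
  classical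
  have hexp : quadHam Γ h * Γ c - Γ c * quadHam Γ h =
      ∑ a, ∑ b, h a b • (Γ a * Γ b * Γ c - Γ c * (Γ a * Γ b)) := by
    simp only [quadHam, sum_mul, mul_sum, smul_mul_assoc, mul_smul_comm, smul_sub, sum_sub_distrib]
  rw [hexp]
  simp_rw [pair_mul_gen_sub hΓ, smul_sub, sum_sub_distrib]
  congr 1
  · -- ∑_a ∑_b h a b • (if b = c then 2 • Γ a else 0) = 2 • Γ(col c)
    rw [fieldOp, smul_sum]
    refine sum_congr rfl fun a _ => ?_
    rw [Finset.sum_eq_single c (fun b _ hb => by rw [if_neg hb, smul_zero])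
      (fun hc => absurd (mem_univ c) hc), if_pos rfl, smul_smul, smul_smul, mul_comm]
  · -- ∑_a ∑_b h a b • (if a = c then 2 • Γ b else 0) = 2 • Γ(row c)
    rw [fieldOp, smul_sum, sum_comm]
    refine sum_congr rfl fun b _ => ?_
    rw [Finset.sum_eq_single c (fun a _ ha => by rw [if_neg ha, smul_zero])
      (fun hc => absurd (mem_univ c) hc), if_pos rfl, smul_smul, smul_smul, mul_comm]

/-- **`[quadHam h, Γ(w)] = Γ(2(h − hᵀ) w)`**: the adjoint action of a quadratic operator preserves the
span of the generators and acts there by the one-body matrix `oneBody h` (Jozsa–Miyake 2008, proof of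
Thm. 3; Terhal–DiVincenzo 2002). [cite: JozsaMiyake2008, proof of Thm. 3] -/
theorem quadHam_mul_fieldOp_sub (hΓ : IsMajoranaFamily Γ) (h : Matrix ι ι ℂ) (w : ι → ℂ) :
    quadHam Γ h * fieldOp Γ w - fieldOp Γ w * quadHam Γ h = fieldOp Γ (oneBody h *ᵥ w) := by
  classical
  have hexp : quadHam Γ h * fieldOp Γ w - fieldOp Γ w * quadHam Γ h =
      ∑ c, w c • (quadHam Γ h * Γ c - Γ c * quadHam Γ h) := by
    simp only [fieldOp, mul_sum, sum_mul, mul_smul_comm, smul_mul_assoc, smul_sub, sum_sub_distrib]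
  have hv : oneBody h *ᵥ w = ∑ c, w c • ((2 : ℂ) • ((fun a => h a c) - (fun b => h c b))) := by
    funext a
    rw [Finset.sum_apply]
    simp only [oneBody, mulVec, dotProduct, Matrix.smul_apply, Matrix.sub_apply, Matrix.transpose_apply,
      smul_eq_mul, Pi.smul_apply, Pi.sub_apply]
    exact sum_congr rfl fun c _ => by ring
  rw [hexp, hv, fieldOp_sum]
  refine sum_congr rfl fun c _ => ?_
  rw [quadHam_mul_gen_sub hΓ, fieldOp_smul, fieldOp_smul, fieldOp_sub]

/-! ### Iterated commutators and conjugation by the exponential -/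

section Exp

/- The `L^∞`-operator norm on matrices is used INSIDE the proofs (Mathlib's `Matrix.Norms.Operator`
scope); the statements only involve `NormedSpace.exp`, which needs no norm (cf. the module docstring
of `Mathlib.Analysis.Normed.Algebra.MatrixExponential`). -/
open scoped Matrix.Norms.Operator

open Literature.Analysis.Calculus.ExpDifferential

/-- `ad_Q Γ(w) = Γ(oneBody h · w)` for `Q = quadHam Γ h`, in the operator notation `ad` of
`Literature.Analysis.Calculus.ExpDifferential`. [cite: JozsaMiyake2008, proof of Thm. 3] -/
theorem ad_quadHam_fieldOp (hΓ : IsMajoranaFamily Γ) (h : Matrix ι ι ℂ) (w : ι → ℂ) :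
    ad ℂ (quadHam Γ h) (fieldOp Γ w) = fieldOp Γ (oneBody h *ᵥ w) := by
  rw [ad_apply]
  exact quadHam_mul_fieldOp_sub hΓ h w

/-- Iterated commutators: `(ad_Q)^k Γ(w) = Γ((oneBody h)^k · w)`. [cite: JozsaMiyake2008, proof of Thm. 3] -/
theorem ad_quadHam_pow_fieldOp (hΓ : IsMajoranaFamily Γ) (h : Matrix ι ι ℂ) (k : ℕ) (w : ι → ℂ) :
    (ad ℂ (quadHam Γ h) ^ k) (fieldOp Γ w) = fieldOp Γ (oneBody h ^ k *ᵥ w) := by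
  induction k generalizing w with
  | zero => simp
  | succ k ih =>
    rw [pow_succ]
    change (ad ℂ (quadHam Γ h) ^ k) (ad ℂ (quadHam Γ h) (fieldOp Γ w)) = _
    rw [ad_quadHam_fieldOp hΓ, ih, Matrix.mulVec_mulVec, ← pow_succ]

set_option backward.isDefEq.respectTransparency false in
set_option synthInstance.maxHeartbeats 200000 in
/-- The series identity behind the main theorem: `e^{ad Q} Γ(w) = Γ(e^{oneBody h} w)` (the exponential
series of `ad Q` applied term by term, `(ad_Q)^k Γ(w) = Γ((oneBody h)^k w)`).
[cite: JozsaMiyake2008, proof of Thm. 3] -/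
theorem exp_ad_quadHam_fieldOp (hΓ : IsMajoranaFamily Γ) (h : Matrix ι ι ℂ) (w : ι → ℂ) :
    exp (ad ℂ (quadHam Γ h)) (fieldOp Γ w) = fieldOp Γ (exp (oneBody h) *ᵥ w) := by
  set Q := quadHam Γ h with hQ
  -- the exponential series of `ad Q`, evaluated at `Γ(w)`
  have h1 : HasSum (fun k : ℕ => (k !⁻¹ : ℂ) • ad ℂ Q ^ k) (exp (ad ℂ Q)) := exp_series_hasSum_exp' _
  let A := ContinuousLinearMap.apply ℂ (Matrix n n ℂ) (fieldOp Γ w)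
  have h1' := h1.map A A.continuous
  have heq : (⇑A ∘ fun k : ℕ => (k !⁻¹ : ℂ) • ad ℂ Q ^ k) =
      fun k : ℕ => fieldOp Γ (((k !⁻¹ : ℂ) • oneBody h ^ k) *ᵥ w) := by
    funext k
    rw [Function.comp_apply, ContinuousLinearMap.apply_apply]
    change (k !⁻¹ : ℂ) • (ad ℂ Q ^ k) (fieldOp Γ w) = _
    rw [hQ, ad_quadHam_pow_fieldOp hΓ, Matrix.smul_mulVec, fieldOp_smul]
  rw [heq, ContinuousLinearMap.apply_apply] at h1'
  -- the exponential series of `oneBody h`, pushed through the continuous linear map `M ↦ Γ(M w)`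
  have h2 : HasSum (fun k : ℕ => (k !⁻¹ : ℂ) • oneBody h ^ k) (exp (oneBody h)) :=
    exp_series_hasSum_exp' _
  let L : Matrix ι ι ℂ →ₗ[ℂ] Matrix n n ℂ :=
    { toFun := fun M => fieldOp Γ (M *ᵥ w)
      map_add' := fun M N => by simp only [Matrix.add_mulVec, fieldOp_add]
      map_smul' := fun c M => by simp only [Matrix.smul_mulVec, fieldOp_smul, RingHom.id_apply] }
  have hL : Continuous L := L.continuous_of_finiteDimensional
  have h2' : HasSum (fun k : ℕ => fieldOp Γ (((k !⁻¹ : ℂ) • oneBody h ^ k) *ᵥ w))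
      (fieldOp Γ (exp (oneBody h) *ᵥ w)) := h2.map L hL
  exact h1'.unique h2'

set_option backward.isDefEq.respectTransparency false in
/-- **Conjugation by the exponential of a quadratic operator rotates the field operators**:
`e^{Q} Γ(w) e^{−Q} = Γ(e^{2(h − hᵀ)} w)` for `Q = ∑_{a,b} h_{ab} Γ_a Γ_b` — the exponential of a
quadratic expression in the generators, "which generally involves all products of all generators",
acts on the `|ι|`-dimensional span of the generators, by the exponential of the one-body matrix
(Jozsa–Miyake 2008, Thm. 3, for antisymmetric `h`: `R = e^{4h}`; Terhal–DiVincenzo 2002; Bravyi 2005;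
Knill 2001). Proof: `Ad(e^Q) = e^{ad Q}` (`ExpDifferential.exp_ad_apply`, Hall Prop. 3.35) and
`exp_ad_quadHam_fieldOp`. [cite: JozsaMiyake2008, Thm. 3] -/
theorem exp_quadHam_mul_fieldOp_mul_exp_neg (hΓ : IsMajoranaFamily Γ) (h : Matrix ι ι ℂ) (w : ι → ℂ) :
    exp (quadHam Γ h) * fieldOp Γ w * exp (-quadHam Γ h) = fieldOp Γ (exp (oneBody h) *ᵥ w) :=
  (exp_ad_apply (𝕂 := ℂ) (quadHam Γ h) (fieldOp Γ w)).symm.trans (exp_ad_quadHam_fieldOp hΓ h w)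

/-- The same for an **antisymmetric** coefficient matrix, `e^{Q} Γ(w) e^{−Q} = Γ(e^{4h} w)`
(Jozsa–Miyake 2008, Thm. 3: "In fact `R = e^{4h}`"). [cite: JozsaMiyake2008, Thm. 3] -/
theorem exp_quadHam_mul_fieldOp_mul_exp_neg_of_transpose (hΓ : IsMajoranaFamily Γ) {h : Matrix ι ι ℂ}
    (hh : hᵀ = -h) (w : ι → ℂ) :
    exp (quadHam Γ h) * fieldOp Γ w * exp (-quadHam Γ h) = fieldOp Γ (exp ((4 : ℂ) • h) *ᵥ w) := by
  rw [exp_quadHam_mul_fieldOp_mul_exp_neg hΓ, oneBody_of_transpose_eq_neg hh]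

/-- **Generator form**: `e^{Q} Γ_c e^{−Q} = ∑_a (e^{B})_{ac} Γ_a`, `B = oneBody h`. With Jozsa–Miyake's
`H = i ∑ h_{μν} c_μ c_ν` (`h` antisymmetric), `U(t) = e^{iHt}`, i.e. `iHt = quadHam c (−t h)`, this is
their `c_μ(t) = U(t) c_μ U(t)† = ∑_ν R_{μν}(t) c_ν`, `R(t) = e^{4ht}` (see the module docstring for
the transposition bookkeeping). [cite: JozsaMiyake2008, Thm. 3] -/
theorem exp_quadHam_mul_gen_mul_exp_neg (hΓ : IsMajoranaFamily Γ) (h : Matrix ι ι ℂ) (c : ι) :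
    exp (quadHam Γ h) * Γ c * exp (-quadHam Γ h) = ∑ a, exp (oneBody h) a c • Γ a := by
  rw [← fieldOp_single Γ c, exp_quadHam_mul_fieldOp_mul_exp_neg hΓ, Matrix.mulVec_single_one]
  rfl

omit [DecidableEq ι] in
set_option backward.isDefEq.respectTransparency false in
/-- `e^{−Q} e^{Q} = 1` for a quadratic operator (an instance of `exp(−X) exp X = 1` in a Banach
algebra, Hall 2015 Prop. 2.3, here recorded norm-free for matrices). [cite: Hall2015, Prop 2.3] -/
theorem exp_neg_quadHam_mul_exp (h : Matrix ι ι ℂ) :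
    exp (-quadHam Γ h) * exp (quadHam Γ h) = 1 :=
  exp_neg_mul_exp_eq_one (𝕂 := ℂ) (quadHam Γ h)

/-- **`e^{Q}` implements the one-body rotation**: `e^{Q} Γ(w) = Γ(e^{oneBody h} w) e^{Q}`, i.e. the
tree's `Implements Γ (e^{Q}) (e^{oneBody h} · )` (Kaufman's correspondence between spin representatives
and rotations, here for the exponential of an arbitrary quadratic expression). [cite: JozsaMiyake2008, Thm. 3] -/
theorem implements_exp_quadHam (hΓ : IsMajoranaFamily Γ) (h : Matrix ι ι ℂ) :
    Implements Γ (exp (quadHam Γ h)) (fun w => exp (oneBody h) *ᵥ w) := by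
  intro w
  rw [← exp_quadHam_mul_fieldOp_mul_exp_neg hΓ h w, mul_assoc (exp (quadHam Γ h) * fieldOp Γ w),
    exp_neg_quadHam_mul_exp, mul_one]

/-- **Bilinears evolve by the same rotation in each slot**:
`e^{Q} Γ(v) Γ(w) e^{−Q} = Γ(e^{B} v) Γ(e^{B} w)`, `B = oneBody h` — hence every two-point function
`⟨Γ(v) Γ(w)⟩` of a state propagated by `e^{Q}` is determined by the `|ι| × |ι|` matrix `e^{B}`
(Terhal–DiVincenzo 2002; Jozsa–Miyake 2008, the paragraph after Thm. 3). [cite: JozsaMiyake2008, Thm. 3] -/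
theorem exp_quadHam_mul_fieldOp_mul_fieldOp_mul_exp_neg (hΓ : IsMajoranaFamily Γ) (h : Matrix ι ι ℂ)
    (v w : ι → ℂ) :
    exp (quadHam Γ h) * (fieldOp Γ v * fieldOp Γ w) * exp (-quadHam Γ h) =
      fieldOp Γ (exp (oneBody h) *ᵥ v) * fieldOp Γ (exp (oneBody h) *ᵥ w) := by
  rw [← exp_quadHam_mul_fieldOp_mul_exp_neg hΓ h v, ← exp_quadHam_mul_fieldOp_mul_exp_neg hΓ h w]
  -- reinsert `e^{-Q} e^{Q} = 1` between the two field operators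
  calc exp (quadHam Γ h) * (fieldOp Γ v * fieldOp Γ w) * exp (-quadHam Γ h)
      = exp (quadHam Γ h) * (fieldOp Γ v * (exp (-quadHam Γ h) * exp (quadHam Γ h)) * fieldOp Γ w) *
          exp (-quadHam Γ h) := by rw [exp_neg_quadHam_mul_exp, mul_one]
    _ = exp (quadHam Γ h) * fieldOp Γ v * exp (-quadHam Γ h) *
          (exp (quadHam Γ h) * fieldOp Γ w * exp (-quadHam Γ h)) := by simp only [mul_assoc]

/-- **Heisenberg form** `e^{−Q} Γ(w) e^{Q} = Γ(e^{−B} w)`, `B = oneBody h` (the main theorem at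
`−h`; with `U = e^{Q}` unitary this is `U† Γ(w) U`, the form displayed in Jozsa–Miyake 2008, Thm. 3).
[cite: JozsaMiyake2008, Thm. 3] -/
theorem exp_neg_quadHam_mul_fieldOp_mul_exp (hΓ : IsMajoranaFamily Γ) (h : Matrix ι ι ℂ) (w : ι → ℂ) :
    exp (-quadHam Γ h) * fieldOp Γ w * exp (quadHam Γ h) = fieldOp Γ (exp (-oneBody h) *ᵥ w) := by
  have := exp_quadHam_mul_fieldOp_mul_exp_neg hΓ (-h) w
  rwa [quadHam_neg, neg_neg, oneBody_neg] at this

end Exp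

/-! ### The `n`-qubit Jordan–Wigner Majoranas -/

section JordanWigner

open Literature.Computability.QuantumComplexity

/-- The tree's Jordan–Wigner Majorana operators on `m` qubits
(`Literature.Computability.QuantumComplexity.majorana`, `c_{(j,b)} = Z^{⊗j} ⊗ (X|Y) ⊗ 1`) form a
Majorana family, so that everything above applies to `m`-mode fermions on `(ℂ²)^{⊗m}`
(Jozsa–Miyake 2008, §5, the Jordan–Wigner representation). [cite: JozsaMiyake2008, §5] -/
theorem isMajoranaFamily_majorana (m : ℕ) :
    IsMajoranaFamily (fun p : Fin m × Bool => majorana m p.1 p.2) where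
  mul_self p := majorana_mul_self m p.1 p.2
  anticomm _ _ hpq := majorana_mul_majorana_of_ne hpq
  conjTranspose_eq p := conjTranspose_majorana m p.1 p.2

/-- **Free-fermion (Gaussian) dynamics on `m` qubits reduces to a `2m × 2m` matrix exponential**:
for the Jordan–Wigner Majoranas `c_p` and any coefficient matrix `h`,
`e^{∑ h_{pq} c_p c_q} (∑_p w_p c_p) e^{−∑ h_{pq} c_p c_q} = ∑_p (e^{2(h − hᵀ)} w)_p c_p`
(Jozsa–Miyake 2008, Thm. 3 with §5; Terhal–DiVincenzo 2002). [cite: JozsaMiyake2008, Thm. 3] -/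
theorem jordanWigner_exp_quadHam_mul_fieldOp_mul_exp_neg (m : ℕ) (h : Matrix (Fin m × Bool) (Fin m × Bool) ℂ)
    (w : Fin m × Bool → ℂ) :
    exp (quadHam (fun p : Fin m × Bool => majorana m p.1 p.2) h) *
        fieldOp (fun p : Fin m × Bool => majorana m p.1 p.2) w *
        exp (-quadHam (fun p : Fin m × Bool => majorana m p.1 p.2) h) =
      fieldOp (fun p : Fin m × Bool => majorana m p.1 p.2) (exp (oneBody h) *ᵥ w) :=
  exp_quadHam_mul_fieldOp_mul_exp_neg (isMajoranaFamily_majorana m) h w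

end JordanWigner

end Literature.MathematicalPhysics.FreeFermions
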